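import Summits.BirchSwinnertonDyer.Rank1Residual.AdditivePotMult.PotMultBranchPAdicGrossZagierCertIff
import Summits.BirchSwinnertonDyer.Rank1Residual.AdditivePotMult.PotMultRankOneWuthrichCertificate
import Summits.BirchSwinnertonDyer.Rank1Residual.AdditivePotMult.PotMultRankOneKatoCertificateBSDOdd
import HarnessLib

/-!
# X3♯(M) (REDUCIBLE `E[p]`, potentially multiplicative) at analytic rank ONE, EVERY odd `p`
# (`p = 3` included): on the unit-certified rows the typed (M) `p`-adic Gross–Zagier formula IS
# `BSD(E,p)` — the CERT-version literal iff, X3♯(M) twin of n1011-p17's (S6)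
# `PotMultBranchPAdicGrossZagierCertIff.lean` (cell `b2b-bsdres`, team n1011, seat p12 (gen 2); lead
# GEN 6 ruling R5-29 offer (n), taken 2026-08-21T08:27Z)

HONEST FRAMING (cell `b2b-bsdres`, run/shared/lean/b2b/bsd-rank1-residual/, verbatim in every
file): the goal of the cell is to DELETE the COMBINATION-SHAPED residual classes of the
Birch–Swinnerton-Dyer formula for ALL analytic-rank `≤ 1` elliptic curves over `ℚ` — "full BSD
formula for every rank `≤ 1` curve in class `C`" assembled STRICTLY from published theorems — so
that the rank-`≤ 1` remainder becomes exactly the CONSTRUCTION-SHAPED classes, which are TYPED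
(missing-input `Prop`s), NOT attempted. This is not "finishing BSD". Team n1011 (RESIDUAL-MAP §I
O7-ord, X3♯(M) share: X3 ∧ pot-mult(p) ∧ `r_an = 1`, every odd `p`): research route on the
CONSTRUCTION-SHAPED class O7; labels and marks UNCHANGED; nothing booked; NO Literature fact minted;
no definition. THEOREMS ONLY; named facts enter as HYPOTHESES (`hW16` = Wuthrich 2014 Thm. 16, the
half-eigenspace divisibility for a semistable curve with REDUCIBLE `E[p]`,
`Wuthrich2014.thm16_halfEigenCharIdeal_dvd_cyclotomicPrime`; `hDelM` =
`Delbourgo2002.mainTheorem_potMult` (A190, supply form only); GZK `hGZK`; modularity `hmod`, `hmodD`;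
`hPal` = Pal 2012 Thm. 3.2 ONLY in the every-odd-`p` one-number form of §5, absent from its odd twin).
OUR conjecture as hypothesis / conclusion: n1011-p01's typed (M) `p`-adic Gross–Zagier
`BranchPAdicGrossZagierMultAt W p Dh` (OPEN in rank one). EVIDENCE-tier input: p07's one-number
certificate `MultBranchUnitCertificateAt W p` (census lane, two engines). No `_holds`; debt 0.

## What this file proves (X3♯(M), `r_an = 1`, EVERY odd `p`; NO `Surj`, NO tower, NO `5 ≤ p`, NO `¬CM`,
NO `ReductionNonAnomalous`, NO `ℓ_p`, NO branch main conjecture)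

p17's (S6) proofs verbatim with Kato's half (`hK` ∧ `Surj W p`) replaced by Wuthrich's Thm. 16
(`hW16`; `E[p]` reducible is part of `ClassX3M`) — i.e. p07's X4(M) §4/§5 theorems replaced by this
seat's X3♯(M) twins `ClassX3M.schneider_and_padicVal_identity_rankOne_of_wuthrichHalf_of_multCert`
(Schneider PROVED) and `ClassX3M.bsdp_iff_padicVal_rankOne_of_wuthrichHalf_of_multCert`
(`BSD(E,p) ⟺ ord_p q + ord_p Reg_p(E,Dh) = 1`); p17's class-free §0
`norm_coeff_one_eq_one_of_multCert_of_disj` (the certificate read on the typed input's disjunction)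
and the tree's valuation helpers BY NAME; nothing restated.

* §1 `ClassX3M.bsdp_rankOne_of_wuthrichHalf_of_multCert_of_branchPAdicGrossZagierMult`: `hW16` +
  certificate + typed (M) pGZ for ONE (B)-datum ⟹ `BSD(E,p)`.
* §2 `ClassX3M.branchPAdicGrossZagierMultAt_of_bsdp_of_wuthrichHalf_of_multCert`: `BSD(E,p)` ⟹ the
  typed (M) pGZ for EVERY (B)-datum (CERT version; p01's (vi) IMC-version takes the branch main
  conjecture instead).
* §3 **`ClassX3M.branchPAdicGrossZagierMultAt_iff_bsdp_of_wuthrichHalf_of_multCert`** (lead offer (n))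
  and its `∀ Dh` form; §4 with Delbourgo 2002 (M) supplying the (B)-datum (`ClassX3M.delbourgo2002`,
  n1011-p16): `ClassX3M.bsdp_iff_{forall,exists}_branchPAdicGrossZagierMultAt_of_wuthrichHalf_of_multCert`.
* §5 one-number headlines: `…_of_wuthrichHalf_of_norm_coeff_one` (every odd `p`, p07's §7 constructor,
  `hPal` carried as there) and the Pal-free odd twin `…_of_norm_coeff_one_of_mod_four_eq_three`
  (`p ≡ 3 (mod 4)`, this seat's `multBranchUnitCertificateAt_of_norm_coeff_one_of_mod_four_eq_three`),
  plus the `p = 3` Q6-record form `ClassX3M.branchPAdicGrossZagierMultAt_three_iff_bsdp_of_wuthrichHalf_of_firstUnitIndex_one`.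

What is NOT claimed: `BranchPAdicGrossZagierMultAt` in rank one (OPEN); the certificate (per pair,
numerical); X4(M) (p17's file); anything booked. Labels UNCHANGED; O7 OPEN; X3 CONSTRUCTION-SHAPED.

References: C. Wuthrich, Doc. Math. 19 (2014) Thm. 16, §3 [Wuthrich2014]; D. Delbourgo, J. Number
Theory 95 (2002) Thm. (A), (B) (p. 40) [Delbourgo2002]; D. Delbourgo, Compositio Math. 113 (1998)
Thm. 1 (shape) [Delbourgo1998]; B. Perrin-Riou, Invent. Math. 89 (1987) §1.4 (shape) [PerrinRiou1987];
B. Mazur, J. Tate, J. Teitelbaum, Invent. Math. 84 (1986) §I.10, §I.13–I.14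
[MazurTateTeitelbaum1986Invent]; A. Pal, Canad. Math. Bull. 55 (2012) Thm. 3.2 [Pal2012]; R. L. Miller,
LMS J. Comput. Math. 14 (2011) Def. 1.1 [Miller2011LMS].
-/

noncomputable section

open scoped Classical MatrixGroups ModularForm NumberField

namespace Summit.BirchSwinnertonDyer.Rank1Residual.AdditivePotMult

open CongruenceSubgroup WeierstrassCurve NumberField Literature.NumberTheory.EllipticCurves
  Literature.NumberTheory.EllipticCurves.ModularForms
  Literature.NumberTheory.EllipticCurves.Rank1Residual
  Literature.NumberTheory.EllipticCurves.Rank1Residual.Typed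
  Literature.NumberTheory.EllipticCurves.Delbourgo2002
  Literature.NumberTheory.GaloisRepresentations
  Summit.BirchSwinnertonDyer.Rank1Residual.Additive
  Summit.BirchSwinnertonDyer.Rank1Residual.X1.MuLambda
  Summit.BirchSwinnertonDyer.Rank1Residual.X1.RankOneParitySqueeze
  IsDedekindDomain

variable {W : WeierstrassCurve ℚ} [W.IsElliptic] [W.IsGloballyMinimal] {p : ℕ} [hp : Fact p.Prime]

/-! ### §1 Wuthrich Thm. 16 + certificate + typed (M) `p`-adic Gross–Zagier for ONE (B)-datum ⟹ `BSD(E,p)` -/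

/-- **X3♯(M), EVERY odd `p` (`p = 3` included), `r_an = 1`, UNIT certificate: Wuthrich's divisibility
and the typed (M) `p`-adic Gross–Zagier for ONE (B)-datum give `BSD(E,p)`** — no main conjecture, no
`ℓ`, no image / CM / `p ≥ 5` / non-anomalous binder: the certificate makes `ord_p(ϖ·[T¹]B) = 0` on the
discharged twist datum (`E♭`, its newform, the branch series of its reduction sign, the period ratio
of the parity), pGZ then reads `1 = ord_p q + ord_p Reg_p(E,Dh)` (Schneider's `Reg_p ≠ 0` is this
seat's T-O7KM-X3 theorem), which is `ClassX3M.bsdp_iff_padicVal_rankOne_of_wuthrichHalf_of_multCert`.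
p17's X4(M) proof verbatim. [cite: Wuthrich2014, Thm. 16 (p. 397)] [cite: Delbourgo2002, Theorem (B) (p. 40)]
[cite: Delbourgo1998, Thm. 1 and §2.5 (shape only)] [cite: Miller2011LMS, Def. 1.1] -/
theorem ClassX3M.bsdp_rankOne_of_wuthrichHalf_of_multCert_of_branchPAdicGrossZagierMult
    (hW16 : Wuthrich2014.thm16_halfEigenCharIdeal_dvd_cyclotomicPrime)
    (hmodD : nonempty_modularParametrizationData)
    (hGZK : rank_eq_analyticRank_of_analyticRank_le_one) (hmod : hasEntireLFunction_rat)
    (hX : ClassX3M W p) (hr : W.analyticRank = 1) (hcert : MultBranchUnitCertificateAt W p)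
    {Dh : PAdicHeightData W p} (hB : LeadingTermClauses W p Dh)
    (hGZ : BranchPAdicGrossZagierMultAt W p Dh) : BSDp W p := by
  have hp2 : p ≠ 2 := hX.p_ne_two
  -- the twist datum, discharged
  obtain ⟨V, iV, iVm, C, hV, hC⟩ := hX.exists_mult_pStar_twist_model
  haveI : NeZero (V.conductorNorm ℤ) := ⟨(V.conductorNorm_pos_holds).ne'⟩
  obtain ⟨Dm⟩ := hmodD V
  obtain ⟨ϖ, hϖ⟩ := exists_periodRatio_parity (p := p) V Dm
  obtain ⟨B, hVB⟩ : ∃ B : PowerSeries ℚ_[p],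
      (V.HasSplitMultiplicativeReductionAtPrime p ∧
          B = if Even (p / 2) then padicLFunctionPlusBranchMult Dm.f (1 : ℚ_[p]) (p / 2)
            else padicLFunctionMinusBranchMult Dm.f (1 : ℚ_[p]) (p / 2)) ∨
        (V.HasMultiplicativeReductionAtPrime p ∧ ¬ V.HasSplitMultiplicativeReductionAtPrime p ∧
          B = if Even (p / 2) then padicLFunctionPlusBranchMult Dm.f (-1 : ℚ_[p]) (p / 2)
            else padicLFunctionMinusBranchMult Dm.f (-1 : ℚ_[p]) (p / 2)) := by
    by_cases hs : V.HasSplitMultiplicativeReductionAtPrime p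
    · exact ⟨_, Or.inl ⟨hs, rfl⟩⟩
    · exact ⟨_, Or.inr ⟨hV, hs, rfl⟩⟩
  -- the certificate: `ord_p(ϖ·[T¹]B) = 0`
  obtain ⟨hx0, hxv⟩ := CensusX42.valuation_eq_zero_of_norm_eq_one (p := p)
    (norm_coeff_one_eq_one_of_multCert_of_disj hcert V C hC Dm.isNewformOf B hVB ϖ hϖ)
  -- pGZ at rank one
  obtain ⟨hmw, -⟩ := hGZK W (by rw [hr])
  have hr1 : W.mordellWeilRank = 1 := by rw [hmw, hr]
  obtain ⟨u, q, hLq, hgz⟩ := hGZ V B hp2 ⟨C, hC⟩ hVB Dm.isNewformOf ϖ hϖ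
  rw [hr1, pow_one] at hgz
  -- Schneider PROVED (T-O7KM-X3 §3) and `q ≠ 0` (modularity)
  have hReg : padicRegulator Dh ≠ 0 :=
    (hX.schneider_and_padicVal_identity_rankOne_of_wuthrichHalf_of_multCert hW16 hmodD hGZK hr hcert
      hB).1
  have hq0 : q ≠ 0 := by
    rintro rfl
    rw [Rat.cast_zero, zero_mul, zero_mul] at hLq
    exact W.leadingLCoeff_ne_zero_holds (hmod W) hLq
  have hqQ : ((q : ℚ) : ℚ_[p]) ≠ 0 := by exact_mod_cast hq0
  have hu0 : ((u : ℤ_[p]) : ℚ_[p]) ≠ 0 := coe_units_ne_zero p u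
  obtain ⟨hlog0, hlogv⟩ := X2.valuation_padicLog_cyclotomicGenerator (p := p) hp2
  -- valuations of both sides of pGZ
  have hval := congrArg Padic.valuation hgz
  rw [Padic.valuation_mul hx0 hlog0, hxv, hlogv, Padic.valuation_mul (mul_ne_zero hu0 hqQ) hReg,
    Padic.valuation_mul hu0 hqQ, valuation_coe_units_eq_zero, zero_add, Padic.valuation_ratCast] at hval
  exact (hX.bsdp_iff_padicVal_rankOne_of_wuthrichHalf_of_multCert hW16 hmodD hGZK hmod hr hcert hB
    hLq).mpr (by linarith)

/-! ### §2 `BSD(E,p)` ⟹ the typed (M) `p`-adic Gross–Zagier for EVERY (B)-datum (CERT version) -/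

/-- **X3♯(M), EVERY odd `p`, `r_an = 1`, UNIT certificate: `BSD(E,p)` ⟹ `BranchPAdicGrossZagierMultAt W p Dh`
for EVERY (B)-datum `Dh`** — for every admissible `(V, C, f, B, ϖ)`: `ord_p(ϖ·[T¹]B·log_p γ) = 0 + 1`
(certificate), `ord_p(q·Reg_p(E,Dh)) = 1` (`BSD(E,p)` through the T-O7KM-X3 criterion,
`q := #Ш_an·∏c/#T²`, Schneider from T-O7KM-X3 §3), so the quotient is a unit of `ℤ_p`. CERT version:
NO branch main conjecture (p01's (vi) IMC-version converse takes it instead of the certificate).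
p17's X4(M) proof verbatim. [cite: Wuthrich2014, Thm. 16 (p. 397)] [cite: Delbourgo2002, Theorem (B) (p. 40)]
[cite: PerrinRiou1987, §1.4 (shape)] [cite: Miller2011LMS, Def. 1.1] -/
theorem ClassX3M.branchPAdicGrossZagierMultAt_of_bsdp_of_wuthrichHalf_of_multCert
    (hW16 : Wuthrich2014.thm16_halfEigenCharIdeal_dvd_cyclotomicPrime)
    (hmodD : nonempty_modularParametrizationData)
    (hGZK : rank_eq_analyticRank_of_analyticRank_le_one) (hmod : hasEntireLFunction_rat)
    (hX : ClassX3M W p) (hr : W.analyticRank = 1) (hcert : MultBranchUnitCertificateAt W p)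
    (hbsd : BSDp W p) {Dh : PAdicHeightData W p} (hB : LeadingTermClauses W p Dh) :
    BranchPAdicGrossZagierMultAt W p Dh := by
  -- rank-one bookkeeping and Schneider (T-O7KM-X3 §3)
  obtain ⟨hmw, hfinSha⟩ := hGZK W (by rw [hr])
  have hr1 : W.mordellWeilRank = 1 := by rw [hmw, hr]
  haveI : Finite W.sha := hfinSha
  have hReg : padicRegulator Dh ≠ 0 :=
    (hX.schneider_and_padicVal_identity_rankOne_of_wuthrichHalf_of_multCert hW16 hmodD hGZK hr hcert
      hB).1
  intro V iV iVm N _ f B hp2 hVW hVB hf ϖ hϖ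
  obtain ⟨C, hC⟩ := hVW
  -- the certificate on this admissible datum
  obtain ⟨hx0, hxv⟩ := CensusX42.valuation_eq_zero_of_norm_eq_one (p := p)
    (norm_coeff_one_eq_one_of_multCert_of_disj hcert V C hC hf B hVB ϖ hϖ)
  -- `q` with `L'(E,1) = q·Ω_E·Reg_∞` from the rationality of `#Ш_an` under `BSD(E,p)`
  obtain ⟨s, hs, -⟩ := missingPPartAt_of_bsdp W p hbsd
  have hΩpos : 0 < W.realPeriodRat := W.realPeriodRat_pos_holds
  have hT0 : W.torsionOrder ≠ 0 := (W.torsionOrder_pos_holds).ne'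
  have hPpos : 0 < W.tamagawaProduct := W.tamagawaProduct_pos_holds
  have hRpos : 0 < W.regulator := regulator_pos_holds W
  set q : ℚ := s * (W.tamagawaProduct : ℚ) / (W.torsionOrder : ℚ) ^ 2 with hq_def
  have hLq : W.leadingLCoeff = (q : ℂ) * (W.realPeriodRat : ℂ) * (W.regulator : ℂ) := by
    have hΩC : (W.realPeriodRat : ℂ) ≠ 0 := by exact_mod_cast hΩpos.ne'
    have hTC : (W.torsionOrder : ℂ) ≠ 0 := by exact_mod_cast hT0
    have hPC : (W.tamagawaProduct : ℂ) ≠ 0 := by exact_mod_cast hPpos.ne'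
    have hRC : (W.regulator : ℂ) ≠ 0 := by exact_mod_cast hRpos.ne'
    have h := hs
    rw [shaAn_def, div_eq_iff (mul_ne_zero (mul_ne_zero hΩC hPC) hRC)] at h
    rw [hq_def]
    push_cast
    field_simp
    linear_combination h
  -- T-O7KM-X3 §4: `ord_p q + ord_p Reg_p(Dh) = 1`
  have hvq : padicValRat p q + (padicRegulator Dh).valuation = 1 :=
    (hX.bsdp_iff_padicVal_rankOne_of_wuthrichHalf_of_multCert hW16 hmodD hGZK hmod hr hcert hB hLq).mp
      hbsd
  have hq0 : q ≠ 0 := by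
    intro h0
    rw [h0, Rat.cast_zero, zero_mul, zero_mul] at hLq
    exact W.leadingLCoeff_ne_zero_holds (hmod W) hLq
  have hqQ : ((q : ℚ) : ℚ_[p]) ≠ 0 := by exact_mod_cast hq0
  obtain ⟨hlog0, hlogv⟩ := X2.valuation_padicLog_cyclotomicGenerator (p := p) hp2
  -- the quotient `(ϖ[T¹]B·log γ)/(q·Reg_p)` is a unit
  set num : ℚ_[p] := ((ϖ : ℚ) : ℚ_[p]) * PowerSeries.coeff 1 B * padicLog p (cyclotomicGenerator p)
    with hnum
  set den : ℚ_[p] := ((q : ℚ) : ℚ_[p]) * padicRegulator Dh with hden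
  have hnum0 : num ≠ 0 := mul_ne_zero hx0 hlog0
  have hden0 : den ≠ 0 := mul_ne_zero hqQ hReg
  have hnumv : num.valuation = 1 := by
    rw [hnum, Padic.valuation_mul hx0 hlog0, hxv, hlogv, zero_add]
  have hdenv : den.valuation = 1 := by
    rw [hden, Padic.valuation_mul hqQ hReg, Padic.valuation_ratCast]
    exact hvq
  have hcancel : num / den * den = num := div_mul_cancel₀ num hden0
  have hxval : (num / den).valuation = 0 := by
    have hv := congrArg Padic.valuation hcancel
    rw [Padic.valuation_mul (div_ne_zero hnum0 hden0) hden0, hnumv, hdenv] at hv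
    linarith
  obtain ⟨u, hu⟩ := exists_units_coe_eq_of_valuation_eq_zero (div_ne_zero hnum0 hden0) hxval
  refine ⟨u, q, hLq, ?_⟩
  rw [hr1, pow_one, hu]
  simp only [hnum, hden] at hcancel ⊢
  linear_combination -hcancel

/-! ### §3 On the unit-certified X3♯(M) rows the typed `p`-adic Gross–Zagier IS `BSD(E,p)` -/

/-- **X3♯(M), EVERY odd `p` (`p = 3` included), `r_an = 1`, UNIT certificate, `Dh` a (B)-datum:
`BranchPAdicGrossZagierMultAt W p Dh ↔ BSDp W p`** (lead GEN 6 offer (n)). The typed (M) `p`-adic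
Gross–Zagier formula at the additive prime (OPEN in rank one) and the `p`-part of BSD are ONE
statement on these rows — given Wuthrich's Thm. 16 (published; NO image hypothesis: `E[p]` is
reducible) and p07's one-number certificate (EVIDENCE). Nothing booked; O7 OPEN.
[cite: Wuthrich2014, Thm. 16 (p. 397)] [cite: Delbourgo2002, Theorem (B) (p. 40)]
[cite: Delbourgo1998, Thm. 1 (shape)] [cite: Miller2011LMS, Def. 1.1] -/
theorem ClassX3M.branchPAdicGrossZagierMultAt_iff_bsdp_of_wuthrichHalf_of_multCert
    (hW16 : Wuthrich2014.thm16_halfEigenCharIdeal_dvd_cyclotomicPrime)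
    (hmodD : nonempty_modularParametrizationData)
    (hGZK : rank_eq_analyticRank_of_analyticRank_le_one) (hmod : hasEntireLFunction_rat)
    (hX : ClassX3M W p) (hr : W.analyticRank = 1) (hcert : MultBranchUnitCertificateAt W p)
    {Dh : PAdicHeightData W p} (hB : LeadingTermClauses W p Dh) :
    BranchPAdicGrossZagierMultAt W p Dh ↔ BSDp W p :=
  ⟨fun hGZ ↦ hX.bsdp_rankOne_of_wuthrichHalf_of_multCert_of_branchPAdicGrossZagierMult hW16 hmodD hGZK
      hmod hr hcert hB hGZ,
    fun hbsd ↦ hX.branchPAdicGrossZagierMultAt_of_bsdp_of_wuthrichHalf_of_multCert hW16 hmodD hGZK hmod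
      hr hcert hbsd hB⟩

/-- **`∀ Dh` form**: on the unit-certified X3♯(M) ∧ `r_an = 1` rows, every odd `p`, for EVERY (B)-datum
`Dh`: `BranchPAdicGrossZagierMultAt W p Dh ↔ BSDp W p`. [cite: Miller2011LMS, Def. 1.1] -/
theorem ClassX3M.forall_branchPAdicGrossZagierMultAt_iff_bsdp_of_wuthrichHalf_of_multCert
    (hW16 : Wuthrich2014.thm16_halfEigenCharIdeal_dvd_cyclotomicPrime)
    (hmodD : nonempty_modularParametrizationData)
    (hGZK : rank_eq_analyticRank_of_analyticRank_le_one) (hmod : hasEntireLFunction_rat)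
    (hX : ClassX3M W p) (hr : W.analyticRank = 1) (hcert : MultBranchUnitCertificateAt W p) :
    ∀ Dh : PAdicHeightData W p, LeadingTermClauses W p Dh →
      (BranchPAdicGrossZagierMultAt W p Dh ↔ BSDp W p) :=
  fun _ hB ↦ hX.branchPAdicGrossZagierMultAt_iff_bsdp_of_wuthrichHalf_of_multCert hW16 hmodD hGZK hmod hr
    hcert hB

/-! ### §4 With Delbourgo 2002 (M) supplying the (B)-datum -/

/-- **X3♯(M), EVERY odd `p`, `r_an = 1`, UNIT certificate, WITH Delbourgo 2002 (M)** (`hDelM`; no CM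
and the twist witness AUTOMATIC on X3♯(M), n1011-p16's `ClassX3M.delbourgo2002`):
`BSD(E,p) ↔ (∀ (B)-datum Dh, BranchPAdicGrossZagierMultAt W p Dh)`.
[cite: Delbourgo2002, Theorem (A), (B) (p. 40)] [cite: Wuthrich2014, Thm. 16 (p. 397)] [cite: Miller2011LMS, Def. 1.1] -/
theorem ClassX3M.bsdp_iff_forall_branchPAdicGrossZagierMultAt_of_wuthrichHalf_of_multCert
    (hDelM : Delbourgo2002.mainTheorem_potMult)
    (hW16 : Wuthrich2014.thm16_halfEigenCharIdeal_dvd_cyclotomicPrime)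
    (hmodD : nonempty_modularParametrizationData)
    (hGZK : rank_eq_analyticRank_of_analyticRank_le_one) (hmod : hasEntireLFunction_rat)
    (hX : ClassX3M W p) (hr : W.analyticRank = 1) (hcert : MultBranchUnitCertificateAt W p) :
    BSDp W p ↔ ∀ Dh : PAdicHeightData W p, LeadingTermClauses W p Dh →
      BranchPAdicGrossZagierMultAt W p Dh := by
  refine ⟨fun hbsd Dh hB ↦ hX.branchPAdicGrossZagierMultAt_of_bsdp_of_wuthrichHalf_of_multCert hW16
    hmodD hGZK hmod hr hcert hbsd hB, fun h ↦ ?_⟩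
  obtain ⟨-, Dh, hB⟩ := hX.delbourgo2002 hDelM
  exact hX.bsdp_rankOne_of_wuthrichHalf_of_multCert_of_branchPAdicGrossZagierMult hW16 hmodD hGZK hmod hr
    hcert hB (h Dh hB)

/-- **`∃` form**, WITH Delbourgo 2002 (M): `BSD(E,p) ↔ ∃ Dh, LeadingTermClauses W p Dh ∧
BranchPAdicGrossZagierMultAt W p Dh` — the typed (M) pGZ for ONE (B)-datum is exactly the missing
analytic input on X3♯(M). [cite: Delbourgo2002, Theorem (A), (B) (p. 40)] [cite: Miller2011LMS, Def. 1.1] -/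
theorem ClassX3M.bsdp_iff_exists_branchPAdicGrossZagierMultAt_of_wuthrichHalf_of_multCert
    (hDelM : Delbourgo2002.mainTheorem_potMult)
    (hW16 : Wuthrich2014.thm16_halfEigenCharIdeal_dvd_cyclotomicPrime)
    (hmodD : nonempty_modularParametrizationData)
    (hGZK : rank_eq_analyticRank_of_analyticRank_le_one) (hmod : hasEntireLFunction_rat)
    (hX : ClassX3M W p) (hr : W.analyticRank = 1) (hcert : MultBranchUnitCertificateAt W p) :
    BSDp W p ↔ ∃ Dh : PAdicHeightData W p, LeadingTermClauses W p Dh ∧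
      BranchPAdicGrossZagierMultAt W p Dh := by
  refine ⟨fun hbsd ↦ ?_, fun ⟨Dh, hB, hGZ⟩ ↦
    hX.bsdp_rankOne_of_wuthrichHalf_of_multCert_of_branchPAdicGrossZagierMult hW16 hmodD hGZK hmod hr
      hcert hB hGZ⟩
  obtain ⟨-, Dh, hB⟩ := hX.delbourgo2002 hDelM
  exact ⟨Dh, hB, hX.branchPAdicGrossZagierMultAt_of_bsdp_of_wuthrichHalf_of_multCert hW16 hmodD hGZK hmod
    hr hcert hbsd hB⟩

/-! ### §5 Headlines from ONE number: every odd `p` (p07's §7, `hPal` carried) and Pal-free odd twins -/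

/-- **HEADLINE (X3♯(M), EVERY odd `p`, `r_an = 1`, `Dh` a (B)-datum): `BranchPAdicGrossZagierMultAt W p Dh
↔ BSDp W p`, GIVEN Wuthrich's divisibility and ONE `p`-adic unit** — the linear coefficient of the
Néron-normalised multiplicative branch of `E♭` (`hone`; the constant term `0` is a THEOREM when
`L(E,1) = 0`, p07's `multBranchUnitCertificateAt_of_norm_coeff_one`, `hPal` carried for its uniform
signature). [cite: Wuthrich2014, Thm. 16 (p. 397)] [cite: Delbourgo2002, Theorem (B) (p. 40)]
[cite: Pal2012, Thm. 3.2] [cite: Miller2011LMS, Def. 1.1] -/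
theorem ClassX3M.branchPAdicGrossZagierMultAt_iff_bsdp_of_wuthrichHalf_of_norm_coeff_one
    (hW16 : Wuthrich2014.thm16_halfEigenCharIdeal_dvd_cyclotomicPrime)
    (hPal : Pal2012.thm32_sqrt_mul_realPeriodRat_twist_eq_of_prime_one_mod_four)
    (hmodD : nonempty_modularParametrizationData)
    (hGZK : rank_eq_analyticRank_of_analyticRank_le_one) (hmod : hasEntireLFunction_rat)
    (hX : ClassX3M W p) (hr : W.analyticRank = 1)
    (hone : ∀ (V : WeierstrassCurve ℚ) [V.IsElliptic] [V.IsGloballyMinimal] (C : VariableChange ℚ),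
      Mult V p → C • V.quadraticTwist ((-1 : ℚ) ^ (p / 2) * p) = W →
      ∀ {N : ℕ} [NeZero N] (f : CuspForm (Gamma0 N) 2), IsNewformOf V f → ∀ (ap : ℤ), cuspCoeff f p = ap →
      ∀ ϖ : ℚ, (if Even (p / 2) then (ϖ : ℝ) * V.realPeriodRat = plusPeriod f
          else (ϖ : ℝ) * V.imaginaryPeriodRat = minusPeriod f) →
        ‖PowerSeries.coeff 1 (PowerSeries.C (ϖ : ℚ_[p]) *
            (if Even (p / 2) then padicLFunctionPlusBranchMult f (ap : ℚ_[p]) (p / 2)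
              else padicLFunctionMinusBranchMult f (ap : ℚ_[p]) (p / 2)))‖ = 1)
    {Dh : PAdicHeightData W p} (hB : LeadingTermClauses W p Dh) :
    BranchPAdicGrossZagierMultAt W p Dh ↔ BSDp W p :=
  hX.branchPAdicGrossZagierMultAt_iff_bsdp_of_wuthrichHalf_of_multCert hW16 hmodD hGZK hmod hr
    (multBranchUnitCertificateAt_of_norm_coeff_one hPal hmod hX.p_ne_two hX.potMult.1
      (entireLFunction_one_eq_zero_of_analyticRank_ne_zero hmod (by rw [hr]; exact one_ne_zero)) hone)
    hB

/-- **Pal-free odd twin** (X3♯(M), `p ≡ 3 (mod 4)` incl. `p = 3`, `r_an = 1`): `BranchPAdicGrossZagierMultAt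
W p Dh ↔ BSDp W p` from ONE `p`-adic unit, NO `hPal` (this seat's
`multBranchUnitCertificateAt_of_norm_coeff_one_of_mod_four_eq_three`).
[cite: Wuthrich2014, Thm. 16 (p. 397)] [cite: Delbourgo2002, Theorem (B) (p. 40)] [cite: Miller2011LMS, Def. 1.1] -/
theorem ClassX3M.branchPAdicGrossZagierMultAt_iff_bsdp_of_wuthrichHalf_of_norm_coeff_one_of_mod_four_eq_three
    (hW16 : Wuthrich2014.thm16_halfEigenCharIdeal_dvd_cyclotomicPrime)
    (hmodD : nonempty_modularParametrizationData)
    (hGZK : rank_eq_analyticRank_of_analyticRank_le_one) (hmod : hasEntireLFunction_rat)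
    (hp4 : p % 4 = 3) (hX : ClassX3M W p) (hr : W.analyticRank = 1)
    (hone : ∀ (V : WeierstrassCurve ℚ) [V.IsElliptic] [V.IsGloballyMinimal] (C : VariableChange ℚ),
      Mult V p → C • V.quadraticTwist ((-1 : ℚ) ^ (p / 2) * p) = W →
      ∀ {N : ℕ} [NeZero N] (f : CuspForm (Gamma0 N) 2), IsNewformOf V f → ∀ (ap : ℤ), cuspCoeff f p = ap →
      ∀ ϖ : ℚ, (if Even (p / 2) then (ϖ : ℝ) * V.realPeriodRat = plusPeriod f
          else (ϖ : ℝ) * V.imaginaryPeriodRat = minusPeriod f) →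
        ‖PowerSeries.coeff 1 (PowerSeries.C (ϖ : ℚ_[p]) *
            (if Even (p / 2) then padicLFunctionPlusBranchMult f (ap : ℚ_[p]) (p / 2)
              else padicLFunctionMinusBranchMult f (ap : ℚ_[p]) (p / 2)))‖ = 1)
    {Dh : PAdicHeightData W p} (hB : LeadingTermClauses W p Dh) :
    BranchPAdicGrossZagierMultAt W p Dh ↔ BSDp W p :=
  hX.branchPAdicGrossZagierMultAt_iff_bsdp_of_wuthrichHalf_of_multCert hW16 hmodD hGZK hmod hr
    (multBranchUnitCertificateAt_of_norm_coeff_one_of_mod_four_eq_three hmod hp4 hX.potMult.1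
      (entireLFunction_one_eq_zero_of_analyticRank_ne_zero hmod (by rw [hr]; exact one_ne_zero)) hone)
    hB

/-- **`p = 3`, Q6-record form** (X3♯(M)@3, `r_an = 1`): census-ctyper1's `CensusQ6.MultOddFirstUnitIndexAt W 3 1`
⟹ `BranchPAdicGrossZagierMultAt W 3 Dh ↔ BSDp W 3` for every (B)-datum `Dh`. NO `hPal`.
[cite: Wuthrich2014, Thm. 16 (p. 397)] [cite: Delbourgo2002, Theorem (B) (p. 40)] [cite: Miller2011LMS, Def. 1.1] -/
theorem ClassX3M.branchPAdicGrossZagierMultAt_three_iff_bsdp_of_wuthrichHalf_of_firstUnitIndex_one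
    {W : WeierstrassCurve ℚ} [W.IsElliptic] [W.IsGloballyMinimal] [Fact (Nat.Prime 3)]
    (hW16 : Wuthrich2014.thm16_halfEigenCharIdeal_dvd_cyclotomicPrime)
    (hmodD : nonempty_modularParametrizationData)
    (hGZK : rank_eq_analyticRank_of_analyticRank_le_one) (hmod : hasEntireLFunction_rat)
    (hX : ClassX3M W 3) (hr : W.analyticRank = 1) (hrec : CensusQ6.MultOddFirstUnitIndexAt W 3 1)
    {Dh : PAdicHeightData W 3} (hB : LeadingTermClauses W 3 Dh) :
    BranchPAdicGrossZagierMultAt W 3 Dh ↔ BSDp W 3 :=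
  hX.branchPAdicGrossZagierMultAt_iff_bsdp_of_wuthrichHalf_of_multCert hW16 hmodD hGZK hmod hr
    (multBranchUnitCertificateAt_of_firstUnitIndex_one_of_mod_four_eq_three hmod (by decide)
      hX.potMult.1 (entireLFunction_one_eq_zero_of_analyticRank_ne_zero hmod (by rw [hr]; exact one_ne_zero))
      hrec)
    hB

end Summit.BirchSwinnertonDyer.Rank1Residual.AdditivePotMult

end
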